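import Summits.ValiantsHypothesis.ValiantsHypothesis.Theorems.KPlusLogSqLawWeakLiftingTowerGraftTwoSidedExchangeSplit
import Summits.ValiantsHypothesis.ValiantsHypothesis.Theorems.KPlusLogSqLawWeakLiftingTowerGraftTwoSidedClusteredAll

/-!
# Tower graft line — A LINEAR LAW FOR ONE-PIVOT WORDS ON EVERY COMMENSURABLE SUPPORT (census currency; towers included)

Crux `stmt-ValiantsHypothesis-19561` (`WeakLifting`), line (B) `tower_graft`, two-sided word instrument; seat val-sym-lift-p3 g21,
`--supports 19561`, NO stub claimed.  Census form of `…TwoSidedExchangeSplit`: the word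
`F(X) = X^{d₀} P₀ + X^{d₀+e} J + Σₗ X^{d₀+e(qₗ+1)} Pₗ` (`P₀ ≻ 0`, `J` ANY symmetric, `Pₗ ⪰ 0`, `qₗ ≥ 1`, a positive definite top letter)
— exponent vector `Matrix.vecCons d₀ (Matrix.vecCons (d₀+e) (fun l => d₀ + e*(q l+1)))`, letters `Matrix.vecCons P₀ (Matrix.vecCons J P)`,
the currency of `…TwoSidedClusteredAll` whose evaluation / kernel / type-dictionary lemmas are reused — has, under simple crossings, at most
`2(m + m·Σₗ qₗ)` positive roots counted with multiplicity (`card_posRoots_le_commensurable`): entering-type roots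
`≤ rank P₀ + Σₗ qₗ·rank Pₗ` (`card_negType_roots_le_commensurable`) and `N⁺ = N⁻` by `Inertia.global_index_formula`.  Every support
`(0, 1, d₂, …, d_K)` is commensurable (`e = 1`, `qₗ = dₗ − 1`); on the 2-towers of the cell's column: `(0,1,5,25)` ⇒ `Z₊ ≤ 2m·29`,
`(0,1,6,36)` ⇒ `Z₊ ≤ 2m·41` (located truths `4m − 2`, `3m`).  Descartes' count for the same determinants is of order `m^{L+1}`.
HONEST FRAMING: linear in `m` but growing with the far exponents — NOT the tower graft law (S5) and no bearing on S4…S5, `TowerB`,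
`WeakLifting` in its window, Conjecture B, 18050 or `VP ≠ VNP`.  Def-free.

[folklore] exchange certificates + the inertia kit's global index formula.
-/

set_option linter.dupNamespace false
set_option autoImplicit false

namespace Summit.ValiantsHypothesis.ValiantsHypothesis.Theorems.KPlusLogSqLaw.TowerGraft

open Matrix
open scoped BigOperators

namespace TwoSidedThree

/-! ## Census currency: one-pivot words on COMMENSURABLE supports (pivot gap divides every gap), any length -/

section CommensurableCensus

open Polynomial
open Summit.ValiantsHypothesis.ValiantsHypothesis.Theorems.LacunarySymmetroidMatrixDescartes

variable {m L : ℕ}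

/-- **entering-type roots of a one-pivot word on a commensurable support number at most `rank P₀ + Σₗ qₗ·rank Pₗ`**
(census currency; `P₀, Pₗ ⪰ 0`, `J` symmetric, exponents `d₀, d₀+e, d₀+e(qₗ+1)`, `qₗ ≥ 1`). [folklore] -/
theorem card_negType_roots_le_commensurable (P₀ J : Matrix (Fin m) (Fin m) ℝ) (P : Fin L → Matrix (Fin m) (Fin m) ℝ)
    (hP₀ : P₀.PosSemidef) (hJ : J.IsSymm) (hP : ∀ l, (P l).PosSemidef) (d₀ e : ℕ) (q : Fin L → ℕ) (he : 0 < e)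
    (hq : ∀ l, 1 ≤ q l) (T : Finset ℝ) (hT : ∀ t ∈ T, 0 < t)
    (hroot : ∀ t ∈ T, ∃ u : Fin m → ℝ,
      (∑ k : Fin (L + 2), t ^ (Matrix.vecCons d₀ (Matrix.vecCons (d₀ + e) fun l => d₀ + e * (q l + 1)) k) •
        (Matrix.vecCons P₀ (Matrix.vecCons J P) k)) *ᵥ u = 0 ∧
      (derivative (∑ k : Fin (L + 2), C (u ⬝ᵥ ((Matrix.vecCons P₀ (Matrix.vecCons J P) k) *ᵥ u)) *
        (X : ℝ[X]) ^ (Matrix.vecCons d₀ (Matrix.vecCons (d₀ + e) fun l => d₀ + e * (q l + 1)) k))).eval t < 0) :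
    T.card ≤ P₀.rank + ∑ l, q l * (P l).rank := by
  classical
  choose! u hu using hroot
  have hqe : ∀ l, e ≤ e * (q l + 1) := fun l => Nat.le_mul_of_pos_right e (Nat.succ_pos _)
  have h := card_negType_le_rank_commensurable (I := T) P₀ J P e (fun l => e * (q l + 1)) q (fun t => (t : ℝ))
    (fun t => u t) hP₀ hJ hP (fun t => hT t t.2) Subtype.coe_injective he hq (fun l => rfl)
    (fun t => reduced_kernel_clustered P₀ J P d₀ e (fun l => e * (q l + 1)) (hT t t.2) _ (hu t t.2).1) ?_
  · simpa using h
  · intro t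
    have ht := hT t t.2
    have hneg := (hu t t.2).2
    have heq := rayleigh_deriv_eq_clustered P₀ J P d₀ e (fun l => e * (q l + 1)) hqe ht _ (hu t t.2).1
    have h1 : (t : ℝ) * (derivative (∑ k : Fin (L + 2), C (u t ⬝ᵥ ((Matrix.vecCons P₀ (Matrix.vecCons J P) k) *ᵥ u t)) *
        (X : ℝ[X]) ^ (Matrix.vecCons d₀ (Matrix.vecCons (d₀ + e) fun l => d₀ + e * (q l + 1)) k))).eval (t : ℝ) < 0 :=
      mul_neg_of_pos_of_neg ht hneg
    rw [heq] at h1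
    have h2 : 0 < (t : ℝ) ^ d₀ := pow_pos ht _
    have h3 : (∑ l, ((e * (q l + 1) - e : ℕ) : ℝ) * (t : ℝ) ^ (e * (q l + 1)) * (u t ⬝ᵥ (P l *ᵥ u t)))
        - e * (u t ⬝ᵥ (P₀ *ᵥ u t)) < 0 := by
      by_contra hcon
      push Not at hcon
      have := mul_nonneg h2.le hcon
      linarith
    linarith

/-- **A LINEAR LAW FOR ONE-PIVOT WORDS ON EVERY COMMENSURABLE SUPPORT (simple crossings; towers included).**  `P₀ ≻ 0` at `d₀`,
`J` ANY symmetric at `d₀ + e` (`e ≥ 1`), ANY NUMBER `L` of positive semidefinite letters `Pₗ` at `d₀ + e(qₗ + 1)`, `qₗ ≥ 1` (the pivot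
gap `e` DIVIDES every gap — every support `(0, 1, d₂, …, d_K)` qualifies, in particular the cell's TOWERS `(0,1,5,25)`, `(0,1,6,36)`),
among them a positive definite top letter `P_{l₁}` (`qₗ < q_{l₁}`, `l ≠ l₁`: the inertia kit's global index formula needs ONE nonsingular
letter at the maximal exponent; with a tie at the top merge the tied letters into one PSD letter first).  If every positive root of `det F` is a simple crossing then
the positive roots of `det F` counted with multiplicity number at most `2·(m + m·Σₗ qₗ)`: entering-type roots `≤ rank P₀ + Σₗ qₗ rank Pₗ`
(`card_negType_roots_le_commensurable`, exchange certificate split into `qₗ` rank-one corrections) and `N⁺ = N⁻`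
(`Inertia.global_index_formula`).  LINEAR IN `m` WITHOUT CLUSTERING; Descartes' count for the same determinant is of order `m^{L+1}`.
On `(0,1,6,36)`: `Z₊ ≤ 2m(1 + 5 + 35) = 82m` (located truth `3m` at `m = 2`); the constant grows with the exponent ratios, so this is
NOT a tower graft law (whose cost must not depend on the far exponent) — it is the first m-linear kernel bound for this sign class on towers.
[folklore] -/
theorem card_posRoots_le_commensurable (P₀ J : Matrix (Fin m) (Fin m) ℝ) (P : Fin L → Matrix (Fin m) (Fin m) ℝ)
    (hP₀ : P₀.PosDef) (hJ : J.IsSymm) (hP : ∀ l, (P l).PosSemidef) (l₁ : Fin L) (htop : (P l₁).PosDef)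
    (d₀ e : ℕ) (q : Fin L → ℕ) (he : 0 < e) (hq : ∀ l, 1 ≤ q l) (hqtop : ∀ l, l ≠ l₁ → q l < q l₁)
    (hcorank : ∀ t : ℝ, 0 < t →
      (∑ k : Fin (L + 2), t ^ (Matrix.vecCons d₀ (Matrix.vecCons (d₀ + e) fun l => d₀ + e * (q l + 1)) k) •
        (Matrix.vecCons P₀ (Matrix.vecCons J P) k)).det = 0 →
      (∑ k : Fin (L + 2), t ^ (Matrix.vecCons d₀ (Matrix.vecCons (d₀ + e) fun l => d₀ + e * (q l + 1)) k) •
        (Matrix.vecCons P₀ (Matrix.vecCons J P) k)).rank + 1 = m)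
    (htype : ∀ t : ℝ, 0 < t →
      (∑ k : Fin (L + 2), t ^ (Matrix.vecCons d₀ (Matrix.vecCons (d₀ + e) fun l => d₀ + e * (q l + 1)) k) •
        (Matrix.vecCons P₀ (Matrix.vecCons J P) k)).det = 0 →
      (∀ u : Fin m → ℝ, (∑ k : Fin (L + 2), t ^ (Matrix.vecCons d₀ (Matrix.vecCons (d₀ + e) fun l => d₀ + e * (q l + 1)) k) •
          (Matrix.vecCons P₀ (Matrix.vecCons J P) k)) *ᵥ u = 0 → u ≠ 0 →
        (derivative (∑ k : Fin (L + 2), C (u ⬝ᵥ ((Matrix.vecCons P₀ (Matrix.vecCons J P) k) *ᵥ u)) *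
          (X : ℝ[X]) ^ (Matrix.vecCons d₀ (Matrix.vecCons (d₀ + e) fun l => d₀ + e * (q l + 1)) k))).eval t < 0) ∨
      (∀ u : Fin m → ℝ, (∑ k : Fin (L + 2), t ^ (Matrix.vecCons d₀ (Matrix.vecCons (d₀ + e) fun l => d₀ + e * (q l + 1)) k) •
          (Matrix.vecCons P₀ (Matrix.vecCons J P) k)) *ᵥ u = 0 → u ≠ 0 →
        0 < (derivative (∑ k : Fin (L + 2), C (u ⬝ᵥ ((Matrix.vecCons P₀ (Matrix.vecCons J P) k) *ᵥ u)) *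
          (X : ℝ[X]) ^ (Matrix.vecCons d₀ (Matrix.vecCons (d₀ + e) fun l => d₀ + e * (q l + 1)) k))).eval t)) :
    Multiset.card ((Matrix.det (∑ k : Fin (L + 2),
        ((X : ℝ[X]) ^ (Matrix.vecCons d₀ (Matrix.vecCons (d₀ + e) fun l => d₀ + e * (q l + 1)) k)) •
          (Matrix.vecCons P₀ (Matrix.vecCons J P) k).map C)).roots.filter (fun t => 0 < t)) ≤ 2 * (m + m * ∑ l, q l) := by
  classical
  set dv : Fin (L + 2) → ℕ := Matrix.vecCons d₀ (Matrix.vecCons (d₀ + e) fun l => d₀ + e * (q l + 1)) with hdv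
  set Sv : Fin (L + 2) → Matrix (Fin m) (Fin m) ℝ := Matrix.vecCons P₀ (Matrix.vecCons J P) with hSv
  have hP₀s : P₀.IsSymm := by
    have h1 := hP₀.1; unfold Matrix.IsHermitian at h1
    rwa [Matrix.conjTranspose_eq_transpose_of_trivial] at h1
  have hPs : ∀ l, (P l).IsSymm := by
    intro l; have h1 := (hP l).1; unfold Matrix.IsHermitian at h1
    rwa [Matrix.conjTranspose_eq_transpose_of_trivial] at h1
  have hS : ∀ k, (Sv k).IsSymm := by
    intro k
    refine Fin.cases ?_ (fun k => ?_) k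
    · simpa [hSv] using hP₀s
    · refine Fin.cases ?_ (fun l => ?_) k
      · simpa [hSv] using hJ
      · simpa [hSv] using hPs l
  have hdv0 : dv 0 = d₀ := by simp [hdv]
  have hdv1 : dv 1 = d₀ + e := by simp [hdv]
  have hdvl : ∀ l : Fin L, dv l.succ.succ = d₀ + e * (q l + 1) := by intro l; simp [hdv]
  have hmul : ∀ l, e < e * (q l + 1) := by
    intro l
    have := hq l
    calc e = e * 1 := (Nat.mul_one e).symm
      _ < e * (q l + 1) := Nat.mul_lt_mul_of_pos_left (by omega) he
  have hmin : ∀ k : Fin (L + 2), k ≠ 0 → dv 0 < dv k := by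
    intro k hk
    rw [hdv0]
    revert hk
    refine Fin.cases ?_ (fun k => ?_) k
    · intro h; exact absurd rfl h
    · intro _
      refine Fin.cases ?_ (fun l => ?_) k
      · show d₀ < dv 1; rw [hdv1]; omega
      · rw [hdvl]; have := hmul l; omega
  have hmax : ∀ k : Fin (L + 2), k ≠ l₁.succ.succ → dv k < dv l₁.succ.succ := by
    intro k hk
    rw [hdvl l₁]
    revert hk
    refine Fin.cases ?_ (fun k => ?_) k
    · intro _; rw [hdv0]; have := hmul l₁; omega
    · refine Fin.cases ?_ (fun l => ?_) k
      · intro _; show dv 1 < d₀ + e * (q l₁ + 1); rw [hdv1]; have := hmul l₁; omega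
      · intro hne
        rw [hdvl]
        have hl : l ≠ l₁ := fun h => hne (by rw [h])
        have h1 := hqtop l hl
        have h2 : e * (q l + 1) < e * (q l₁ + 1) := Nat.mul_lt_mul_of_pos_left (by omega) he
        omega
  have h0 : (Sv 0).det ≠ 0 := by
    show (Matrix.vecCons P₀ (Matrix.vecCons J P) 0).det ≠ 0
    simp only [Matrix.cons_val_zero]; exact hP₀.det_pos.ne'
  have h2 : (Sv l₁.succ.succ).det ≠ 0 := by
    show (Matrix.vecCons P₀ (Matrix.vecCons J P) l₁.succ.succ).det ≠ 0
    simp only [Matrix.cons_val_succ]; exact htop.det_pos.ne'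
  let negType : ℝ → Prop := fun t => ∀ u : Fin m → ℝ, (∑ k, t ^ dv k • Sv k) *ᵥ u = 0 → u ≠ 0 →
    (derivative (∑ k, C (u ⬝ᵥ (Sv k *ᵥ u)) * (X : ℝ[X]) ^ dv k)).eval t < 0
  obtain ⟨hidx, -, hsum⟩ := Inertia.global_index_formula dv Sv hS 0 l₁.succ.succ hmin hmax h0 h2 htype negType
    (fun t _ _ => Iff.rfl)
  have hν0 : Fintype.card {j // (Inertia.isHermitian_of_isSymm (hS 0)).eigenvalues j < 0} = 0 := by
    rw [Fintype.card_eq_zero_iff]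
    refine ⟨fun ⟨j, hj⟩ => ?_⟩
    have hP₀' : (Sv 0).PosDef := by
      show (Matrix.vecCons P₀ (Matrix.vecCons J P) 0).PosDef
      simp only [Matrix.cons_val_zero]; exact hP₀
    have hp : 0 < (Inertia.isHermitian_of_isSymm (hS 0)).eigenvalues j := hP₀'.eigenvalues_pos j
    linarith
  have hν2 : Fintype.card {j // (Inertia.isHermitian_of_isSymm (hS l₁.succ.succ)).eigenvalues j < 0} = 0 := by
    rw [Fintype.card_eq_zero_iff]
    refine ⟨fun ⟨j, hj⟩ => ?_⟩
    have htop' : (Sv l₁.succ.succ).PosDef := by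
      show (Matrix.vecCons P₀ (Matrix.vecCons J P) l₁.succ.succ).PosDef
      simp only [Matrix.cons_val_succ]; exact htop
    have hp : 0 < (Inertia.isHermitian_of_isSymm (hS l₁.succ.succ)).eigenvalues j := htop'.eigenvalues_pos j
    linarith
  rw [hν0, hν2, zero_add, zero_add] at hidx
  set Pd := Matrix.det (∑ k, ((X : ℝ[X]) ^ dv k) • (Sv k).map C) with hPd
  have hdef : ∀ t : ℝ, 0 < t → (∑ k, t ^ dv k • Sv k).det = 0 → ∀ v : Fin m → ℝ, (∑ k, t ^ dv k • Sv k) *ᵥ v = 0 →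
      v ≠ 0 → (derivative (∑ k, C (v ⬝ᵥ (Sv k *ᵥ v)) * (X : ℝ[X]) ^ dv k)).eval t ≠ 0 := by
    intro t ht hdet v hv hv0
    rcases htype t ht hdet with h | h
    · exact ne_of_lt (h v hv hv0)
    · exact ne_of_gt (h v hv hv0)
  set qn : ℝ → Prop := fun t => 0 < t ∧ negType t with hqn
  have hnodup : (Pd.roots.filter qn).Nodup := by
    rw [Multiset.nodup_iff_count_le_one]
    intro a
    by_cases hqa : qn a
    · rw [Multiset.count_filter_of_pos hqa, count_roots]
      by_cases hr : (∑ k, a ^ dv k • Sv k).det = 0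
      · have h1 := Multiplicity.rootMultiplicity_det_pencil_eq_one dv Sv hS a
          (by rw [Fintype.card_fin]; exact hcorank a hqa.1 hr) (hdef a hqa.1 hr)
        rw [← hPd] at h1
        omega
      · have hnr : ¬ Pd.IsRoot a := by
          intro hroot
          apply hr
          have h1 : Pd.eval a = 0 := hroot
          rwa [hPd, DefiniteMoments.eval_det_pencil] at h1
        rw [Polynomial.rootMultiplicity_eq_zero hnr]
        exact zero_le_one
    · rw [Multiset.count_filter_of_neg hqa]
      exact zero_le_one
  set T := (Pd.roots.filter qn).toFinset with hTdef
  have hTcard : T.card = Multiset.card (Pd.roots.filter qn) := Multiset.toFinset_card_of_nodup hnodup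
  have hTpos : ∀ t ∈ T, 0 < t := fun t ht => (Multiset.mem_filter.mp (Multiset.mem_toFinset.mp ht)).2.1
  have hTroot : ∀ t ∈ T, ∃ u : Fin m → ℝ, (∑ k, t ^ (dv k) • (Sv k)) *ᵥ u = 0 ∧
      (derivative (∑ k, C (u ⬝ᵥ ((Sv k) *ᵥ u)) * (X : ℝ[X]) ^ (dv k))).eval t < 0 := by
    intro t ht
    obtain ⟨hmem, htq⟩ := Multiset.mem_filter.mp (Multiset.mem_toFinset.mp ht)
    obtain ⟨hP0, hroot⟩ := (Polynomial.mem_roots').mp hmem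
    have hdet : (∑ k, t ^ dv k • Sv k).det = 0 := by
      have h1 : Pd.eval t = 0 := hroot
      rwa [hPd, DefiniteMoments.eval_det_pencil] at h1
    obtain ⟨u, hu0, hu⟩ := Matrix.exists_mulVec_eq_zero_iff.mpr hdet
    exact ⟨u, hu, htq.2 u hu hu0⟩
  have hTle : T.card ≤ P₀.rank + ∑ l, q l * (P l).rank :=
    card_negType_roots_le_commensurable P₀ J P hP₀.posSemidef hJ hP d₀ e q he hq T hTpos hTroot
  have hP₀m : P₀.rank ≤ m := (Matrix.rank_le_width P₀).trans le_rfl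
  have hPm : ∀ l, (P l).rank ≤ m := fun l => (Matrix.rank_le_width (P l)).trans le_rfl
  have hsumle : ∑ l, q l * (P l).rank ≤ m * ∑ l, q l := by
    rw [Finset.mul_sum]
    exact Finset.sum_le_sum fun l _ => by
      calc q l * (P l).rank ≤ q l * m := Nat.mul_le_mul_left _ (hPm l)
        _ = m * q l := Nat.mul_comm _ _
  rw [← hsum]
  have hN : Multiset.card (Pd.roots.filter qn) ≤ m + m * ∑ l, q l := by
    rw [← hTcard]; exact hTle.trans (Nat.add_le_add hP₀m hsumle)
  have hidx' : Multiset.card (Pd.roots.filter fun t => 0 < t ∧ ¬ negType t) = Multiset.card (Pd.roots.filter qn) := hidx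
  rw [hidx']
  omega

end CommensurableCensus

end TwoSidedThree

end Summit.ValiantsHypothesis.ValiantsHypothesis.Theorems.KPlusLogSqLaw.TowerGraft
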